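import Literature.NumberTheory.GaloisRepresentations.TwistedSumAlgebraic
import HarnessLib

/-!
# Twisted sums of semisimple representations with a twist of finite order: the one-generator
# unscrewing (algebraic core)

Topic `Literature/NumberTheory/GaloisRepresentations` (theorems only).  A finite-order companion
of the tree's `TwistedSum.exists_isCompl_forall_equiv_prod_twist` (`TwistedSumAlgebraic`, the
algebraic heart of Harris–Lan–Taylor–Thorne 2016, Prop. 7.12).  There the twisting character `μ`
has infinite order and infinitely many twisted packages `R_m ≃ A ⊕ B ⊗ μᵐ` are available; here the
character `χ` may have FINITE order (e.g. prime order `p`), only the packages for the exponents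
`0, ±1, ±2` are used, and infinite order is replaced by a **genericity** hypothesis on `χ` with
respect to the untwisted package `A`: no irreducible constituent of `A` is the `χ`-twist of
another one.  This is the representation-theoretic content of the "virtual character" step of
R. Taylor, *l-adic representations associated to modular forms over imaginary quadratic fields. II*,
Invent. Math. 116 (1994), §3 (the extraction of `ρ` from packages `R_ψ ≅ (ρ ⊗ ψ̃) ⊕ (ρ ⊗ ψ̃)^c`),
in the form needed for cyclic twists of large prime order: with an endomorphism `θ` of `Γ`
(complex conjugation / the quadratic twist `σ ↦ σ^τ`) such that `χ ∘ θ = χ⁻¹`, `A ∘ θ ≃ A` and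
`C₁ ∘ θ ≃ C₁ ⊗ χ⁻¹`, one finds `U ≤ C₁` with `A ≃ U ⊕ U ∘ θ` and `C₁ ≃ U ⊕ (U ∘ θ) ⊗ χ`.

**Main result** (`TwistedSum.exists_halving_of_generic_twist`).  `k` algebraically closed, `Γ` a
group, `θ : Γ →* Γ` surjective, `χ : Γ → kˣ` with `χ (θ g) = (χ g)⁻¹`; `A, C₁, C₋₁, C₂, C₋₂`
finite-dimensional semisimple representations with the Brauer–Nesbitt identities
`C₁ ⊕ C₋₁ ⊗ χ ≃ A ⊗ χ ⊕ A`, `C₂ ⊕ C₋₂ ⊗ χ² ≃ A ⊗ χ² ⊕ A`, `C₁ ⊕ C₁ ⊗ χ ≃ A ⊗ χ ⊕ C₂`, `A ∘ θ ≃ A`,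
`C₁ ∘ θ ≃ C₁ ⊗ χ⁻¹` (these hold when the characters are `tr C_j = T₁ + χ^j T₂` on a dense set, as
for twisted induced packages), and `χ` generic for `A` (`[A : W] > 0 ⇒ [A : W ⊗ χ] = 0`).  Then
there is a subrepresentation `U ≤ C₁` with `A ≃ U ⊕ U ∘ θ` and `C₁ ≃ U ⊕ (U ∘ θ) ⊗ χ`.

*Proof.*  Multiplicities `[R : W]` of irreducibles (`Representation.mult`, Schur), the
decomposition of `C₁` into irreducibles (`Representation.exists_decomposition`): `U` is the sum of
the constituents of `C₁` that occur in `A`, `U''` the sum of the others; the identities give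
`[C₁ : W] ≤ [A : W ⊗ χ⁻¹] + [A : W]`, `[C₂ : W] ≤ [A : W ⊗ χ⁻²] + [A : W]`,
`[C₁ : W] + [C₁ : W ⊗ χ⁻¹] = [A : W ⊗ χ⁻¹] + [C₂ : W]`, and genericity separates the two layers:
`[A : W] = [U : W] + [U'' ⊗ χ⁻¹ : W]` for every irreducible `W`, whence `A ≃ U ⊕ U'' ⊗ χ⁻¹` by
Krull–Schmidt (`Representation.nonempty_equiv_of_mult_eq`); comparing `A ∘ θ ≃ A` and
`C₁ ∘ θ ≃ C₁ ⊗ χ⁻¹` layer by layer gives `U'' ⊗ χ⁻¹ ≃ U ∘ θ`.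

## References

* R. Taylor, *l-adic representations associated to modular forms over imaginary quadratic
  fields. II*, Invent. Math. 116 (1994), 619–643, §3. [Taylor1994]
* M. Harris, K.-W. Lan, R. Taylor, J. Thorne, *On the rigid cohomology of certain Shimura
  varieties*, Res. Math. Sci. 3:37 (2016), §7, Prop. 7.12. [HarrisLanTaylorThorneRMS2016]
* T. Berger, G. Harcos, *ℓ-adic representations associated to modular forms over imaginary
  quadratic fields*, IMRN 2007, §6 (the same unscrewing for `n = 2`). [BergerHarcos2007]
-/

noncomputable section

namespace Literature.NumberTheory.GaloisRepresentations

namespace TwistedSum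

open Literature.RepresentationTheory.Semisimple Literature.RepresentationTheory.FiniteGroups

universe u v w

variable {k : Type u} [Field k] {Γ : Type v} [Group Γ]

/-! ### Composition with an endomorphism of the group -/

section Comp

variable {V : Type w} [AddCommGroup V] [Module k V] {W : Type w} [AddCommGroup W] [Module k W]

/-- Transport of an equivalence along composition with a group endomorphism:
`ρ ≃ σ ⇒ ρ ∘ θ ≃ σ ∘ θ` (same linear isomorphism). [folklore] -/
theorem nonempty_equiv_comp {ρ : Representation k Γ V} {σ : Representation k Γ W}
    (e : Representation.Equiv ρ σ) (θ : Γ →* Γ) :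
    Nonempty (Representation.Equiv (ρ.comp θ : Representation k Γ V)
      (σ.comp θ : Representation k Γ W)) :=
  ⟨Representation.Equiv.mk e.toLinearEquiv fun g => e.isIntertwining' (θ g)⟩

/-- `(ρ ⊕ σ) ∘ θ = ρ ∘ θ ⊕ σ ∘ θ`. [folklore] -/
theorem prod_comp (ρ : Representation k Γ V) (σ : Representation k Γ W) (θ : Γ →* Γ) :
    ((ρ.prod σ).comp θ : Representation k Γ (V × W)) =
      Representation.prod (ρ.comp θ) (σ.comp θ) := rfl

/-- `(ρ ⊗ χ) ∘ θ = (ρ ∘ θ) ⊗ (χ ∘ θ)`. [folklore] -/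
theorem twist_comp (ρ : Representation k Γ V) (χ : Γ →* kˣ) (θ : Γ →* Γ) :
    ((Representation.twist ρ χ).comp θ : Representation k Γ V) =
      Representation.twist (ρ.comp θ : Representation k Γ V) (χ.comp θ) := rfl

/-- Along a **surjective** group endomorphism `θ`, `ρ ∘ θ` is semisimple if `ρ` is (the
subrepresentations are the same subspaces; cf. the tree's
`Representation.isSemisimpleRepresentation_comp_iff_of_surjective` in `AbsGaloisOuterConj`, restated
here to keep this file free of number-field imports). [folklore] -/
theorem isSemisimpleRepresentation_comp (ρ : Representation k Γ V) [hρ : ρ.IsSemisimpleRepresentation]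
    {θ : Γ →* Γ} (hθ : Function.Surjective θ) :
    Representation.IsSemisimpleRepresentation (ρ.comp θ) :=
  (OrderIso.complementedLattice_iff (α := Subrepresentation (W := V) (ρ.comp θ))
    (β := Subrepresentation ρ)
    { toFun := fun W' ↦ ⟨W'.toSubmodule, fun g v hv ↦ by
        obtain ⟨h, rfl⟩ := hθ g
        exact W'.apply_mem_toSubmodule h hv⟩
      invFun := fun W' ↦ ⟨W'.toSubmodule, fun h v hv ↦ W'.apply_mem_toSubmodule (θ h) hv⟩
      left_inv := fun _ ↦ rfl
      right_inv := fun _ ↦ rfl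
      map_rel_iff' := Iff.rfl }).2 hρ

end Comp

/-! ### Multiplicity bookkeeping -/

section Mult

variable {X : Type w} [AddCommGroup X] [Module k X]
  {V : Type w} [AddCommGroup V] [Module k V] {W : Type w} [AddCommGroup W] [Module k W]

/-- `[R ⊗ χ⁻¹ : W] = [R : W ⊗ χ]`. [folklore] -/
theorem mult_twist_inv_eq (Wr : Representation k Γ X) (R : Representation k Γ V) (χ : Γ →* kˣ) :
    Representation.mult Wr (Representation.twist R χ⁻¹) =
      Representation.mult (Representation.twist Wr χ) R := by
  conv_lhs => rw [← Representation.twist_twist_inv Wr χ]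
  exact Representation.mult_twist _ _ _

open Classical in
/-- Multiplicity of an irreducible in a sub-sum of a decomposition: `[⊕_{i ∈ S} Tᵢ : W]` is the
number of indices `i ∈ S` with `W ≃ Tᵢ` (Schur). [folklore] -/
theorem mult_pi_subtype_eq_card [IsAlgClosed k] [FiniteDimensional k X] [FiniteDimensional k V]
    {n : ℕ} {R : Representation k Γ V} (T : Fin n → Subrepresentation R)
    [∀ i, (T i).toRepresentation.IsIrreducible] (S : Finset (Fin n))
    (Wr : Representation k Γ X) [Wr.IsIrreducible] :
    Representation.mult Wr (Representation.pi fun i : {i // i ∈ S} => (T i.1).toRepresentation) =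
      (S.filter fun i => Nonempty (Representation.Equiv Wr (T i).toRepresentation)).card := by
  rw [Representation.mult_pi, Finset.card_filter]
  simp_rw [Representation.mult_eq_ite]
  exact (Finset.sum_subtype S (fun _ => Iff.rfl)
    (fun i : Fin n => if Nonempty (Representation.Equiv Wr (T i).toRepresentation) then 1 else 0)).symm

end Mult

/-! ### The algebraic core -/

section Main

variable [IsAlgClosed k] {V : Type w} [AddCommGroup V] [Module k V] [FiniteDimensional k V]
  {V₁ : Type w} [AddCommGroup V₁] [Module k V₁] [FiniteDimensional k V₁]
  {Vm : Type w} [AddCommGroup Vm] [Module k Vm] [FiniteDimensional k Vm]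
  {V₂ : Type w} [AddCommGroup V₂] [Module k V₂] [FiniteDimensional k V₂]
  {Vm₂ : Type w} [AddCommGroup Vm₂] [Module k Vm₂] [FiniteDimensional k Vm₂]

/-- **One-generator unscrewing of twisted packages (finite-order twists allowed).**  Let `k` be
algebraically closed, `Γ` a group, `θ : Γ → Γ` a surjective endomorphism, `χ : Γ → kˣ` a character
with `χ (θ g) = (χ g)⁻¹`.  Let `A, C₁, C₋₁, C₂, C₋₂` be finite-dimensional semisimple
representations of `Γ` with
`C₁ ⊕ C₋₁ ⊗ χ ≃ A ⊗ χ ⊕ A`, `C₂ ⊕ C₋₂ ⊗ χ² ≃ A ⊗ χ² ⊕ A`, `C₁ ⊕ C₁ ⊗ χ ≃ A ⊗ χ ⊕ C₂`,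
`A ∘ θ ≃ A`, `C₁ ∘ θ ≃ C₁ ⊗ χ⁻¹`, and assume `χ` is GENERIC for `A`: every irreducible `W`
occurring in `A` has `[A : W ⊗ χ] = 0`.  Then there is a subrepresentation `U` of `C₁` with
`A ≃ U ⊕ U ∘ θ` and `C₁ ≃ U ⊕ (U ∘ θ) ⊗ χ`.  (For `χ = ν^k` with `ν` of prime order `p > dim`, the
genericity is the condition "`ν^k ∉ Bad(A)`"; Taylor 1994 §3 / Berger–Harcos 2007 §6 is the case
`dim A = 4`.) [folklore] -/
theorem exists_halving_of_generic_twist (θ : Γ →* Γ) (hθ : Function.Surjective θ)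
    (χ : Γ →* kˣ) (hθχ : ∀ g, χ (θ g) = (χ g)⁻¹)
    (A : Representation k Γ V) (C₁ : Representation k Γ V₁) (Cm₁ : Representation k Γ Vm)
    (C₂ : Representation k Γ V₂) (Cm₂ : Representation k Γ Vm₂)
    [A.IsSemisimpleRepresentation] [C₁.IsSemisimpleRepresentation]
    [Cm₁.IsSemisimpleRepresentation] [C₂.IsSemisimpleRepresentation]
    [Cm₂.IsSemisimpleRepresentation]
    (I₁ : Nonempty (Representation.Equiv (C₁.prod (Representation.twist Cm₁ χ))
      ((Representation.twist A χ).prod A)))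
    (I₂ : Nonempty (Representation.Equiv (C₂.prod (Representation.twist Cm₂ (χ * χ)))
      ((Representation.twist A (χ * χ)).prod A)))
    (I₃ : Nonempty (Representation.Equiv (C₁.prod (Representation.twist C₁ χ))
      ((Representation.twist A χ).prod C₂)))
    (I₄ : Nonempty (Representation.Equiv (A.comp θ : Representation k Γ V) A))
    (I₅ : Nonempty (Representation.Equiv (C₁.comp θ : Representation k Γ V₁)
      (Representation.twist C₁ χ⁻¹)))
    (hgen : ∀ {X : Type w} [AddCommGroup X] [Module k X] [FiniteDimensional k X]
      (Wr : Representation k Γ X) [Wr.IsIrreducible],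
      0 < Representation.mult Wr A → Representation.mult (Representation.twist Wr χ) A = 0) :
    ∃ U : Subrepresentation C₁,
      Nonempty (Representation.Equiv A
        (U.toRepresentation.prod (U.toRepresentation.comp θ : Representation k Γ U.toSubmodule))) ∧
      Nonempty (Representation.Equiv C₁
        (U.toRepresentation.prod (Representation.twist
          (U.toRepresentation.comp θ : Representation k Γ U.toSubmodule) χ))) := by
  classical
  have hχθ : χ.comp θ = χ⁻¹ := MonoidHom.ext fun g => by rw [MonoidHom.comp_apply, hθχ]; rfl
  /- Step 1: constituents of `C₁`, split by occurrence in `A`. -/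
  obtain ⟨n, T, -, hTirr, hcount⟩ := Representation.exists_decomposition C₁
  haveI : ∀ i, (T i).toRepresentation.IsIrreducible := hTirr
  let S : Finset (Fin n) := Finset.univ.filter fun i => 0 < Representation.mult (T i).toRepresentation A
  have hS : ∀ i, i ∈ S ↔ 0 < Representation.mult (T i).toRepresentation A := fun i => by
    simp only [S, Finset.mem_filter, Finset.mem_univ, true_and]
  let σU : Representation k Γ (∀ i : {i // i ∈ S}, (T i.1).toSubmodule) :=
    Representation.pi fun i : {i // i ∈ S} => (T i.1).toRepresentation
  let σU'' : Representation k Γ (∀ i : {i // i ∈ Sᶜ}, (T i.1).toSubmodule) :=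
    Representation.pi fun i : {i // i ∈ Sᶜ} => (T i.1).toRepresentation
  haveI hσUss : σU.IsSemisimpleRepresentation := inferInstance
  haveI hσU''ss : σU''.IsSemisimpleRepresentation := inferInstance
  /- Step 2: the multiplicity functions. For an irreducible `W` write `a W = [A : W]`,
  `c W = [C₁ : W]`, `u W = [σU : W]`, `u'' W = [σU'' : W]`. -/
  -- `u W = c W` if `W` occurs in `A`, else `0`; `u'' W = 0` if `W` occurs in `A`, else `c W`
  have hu : ∀ {X : Type w} [AddCommGroup X] [Module k X] [FiniteDimensional k X]
      (Wr : Representation k Γ X) [Wr.IsIrreducible],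
      Representation.mult Wr σU =
        if 0 < Representation.mult Wr A then Representation.mult Wr C₁ else 0 := by
    intro X _ _ _ Wr _
    rw [mult_pi_subtype_eq_card T S Wr, hcount Wr]
    split_ifs with hA
    · congr 1
      ext i
      simp only [Finset.mem_filter, Finset.mem_univ, true_and, and_iff_right_iff_imp, hS]
      rintro ⟨e⟩
      rwa [← Representation.mult_congr_left e]
    · rw [Finset.card_eq_zero, Finset.filter_eq_empty_iff]
      rintro i hi ⟨e⟩
      apply hA
      rw [Representation.mult_congr_left e]
      exact (hS i).1 hi
  have hu'' : ∀ {X : Type w} [AddCommGroup X] [Module k X] [FiniteDimensional k X]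
      (Wr : Representation k Γ X) [Wr.IsIrreducible],
      Representation.mult Wr σU'' =
        if 0 < Representation.mult Wr A then 0 else Representation.mult Wr C₁ := by
    intro X _ _ _ Wr _
    rw [mult_pi_subtype_eq_card T Sᶜ Wr, hcount Wr]
    split_ifs with hA
    · rw [Finset.card_eq_zero, Finset.filter_eq_empty_iff]
      rintro i hi ⟨e⟩
      rw [Finset.mem_compl] at hi
      apply hi
      rw [hS, ← Representation.mult_congr_left e]
      exact hA
    · congr 1
      ext i
      simp only [Finset.mem_filter, Finset.mem_univ, true_and, and_iff_right_iff_imp,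
        Finset.mem_compl, hS]
      rintro ⟨e⟩
      rwa [← Representation.mult_congr_left e]
  -- genericity, both directions
  have hgen' : ∀ {X : Type w} [AddCommGroup X] [Module k X] [FiniteDimensional k X]
      (Wr : Representation k Γ X) [Wr.IsIrreducible],
      0 < Representation.mult Wr A → Representation.mult (Representation.twist Wr χ⁻¹) A = 0 := by
    intro X _ _ _ Wr _ hA
    by_contra h
    have h1 := hgen (Representation.twist Wr χ⁻¹) (Nat.pos_of_ne_zero h)
    rw [Representation.twist_inv_twist] at h1
    omega
  -- the three numerical consequences of `I₁`, `I₂`, `I₃`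
  have hI₁ : ∀ {X : Type w} [AddCommGroup X] [Module k X] [FiniteDimensional k X]
      (Wr : Representation k Γ X) [Wr.IsIrreducible],
      Representation.mult Wr C₁ ≤ Representation.mult (Representation.twist Wr χ⁻¹) A +
        Representation.mult Wr A := by
    intro X _ _ _ Wr _
    obtain ⟨e⟩ := I₁
    have h := Representation.mult_congr_right Wr e
    rw [Representation.mult_prod, Representation.mult_prod, Representation.mult_twist_right Wr A]
      at h
    omega
  have hI₂ : ∀ {X : Type w} [AddCommGroup X] [Module k X] [FiniteDimensional k X]
      (Wr : Representation k Γ X) [Wr.IsIrreducible],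
      Representation.mult Wr C₂ ≤ Representation.mult (Representation.twist Wr (χ * χ)⁻¹) A +
        Representation.mult Wr A := by
    intro X _ _ _ Wr _
    obtain ⟨e⟩ := I₂
    have h := Representation.mult_congr_right Wr e
    rw [Representation.mult_prod, Representation.mult_prod,
      Representation.mult_twist_right Wr A] at h
    omega
  have hI₃ : ∀ {X : Type w} [AddCommGroup X] [Module k X] [FiniteDimensional k X]
      (Wr : Representation k Γ X) [Wr.IsIrreducible],
      Representation.mult Wr C₁ + Representation.mult (Representation.twist Wr χ⁻¹) C₁ =
        Representation.mult (Representation.twist Wr χ⁻¹) A + Representation.mult Wr C₂ := by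
    intro X _ _ _ Wr _
    obtain ⟨e⟩ := I₃
    have h := Representation.mult_congr_right Wr e
    rw [Representation.mult_prod, Representation.mult_prod, Representation.mult_twist_right Wr C₁,
      Representation.mult_twist_right Wr A] at h
    exact h
  /- Step 3: `A ≃ σU ⊕ σU'' ⊗ χ⁻¹` by comparing multiplicities. -/
  have hmultA : ∀ {X : Type w} [AddCommGroup X] [Module k X] [FiniteDimensional k X]
      (Wr : Representation k Γ X) [Wr.IsIrreducible],
      Representation.mult Wr A =
        Representation.mult Wr (σU.prod (Representation.twist σU'' χ⁻¹)) := by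
    intro X _ _ _ Wr _
    rw [Representation.mult_prod, mult_twist_inv_eq, hu Wr, hu'' (Representation.twist Wr χ)]
    by_cases hA : 0 < Representation.mult Wr A
    · -- `W` occurs in `A`: `a W = c W + c (W ⊗ χ)`
      rw [if_pos hA, if_neg (by rw [hgen Wr hA]; exact lt_irrefl 0)]
      have h3 := hI₃ (Representation.twist Wr χ)
      rw [Representation.twist_twist_inv] at h3
      have h2 := hI₂ (Representation.twist Wr χ)
      rw [Representation.twist_twist, hgen Wr hA, add_zero] at h2
      have hχχ : χ * (χ * χ)⁻¹ = χ⁻¹ := MonoidHom.ext fun g => by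
        simp only [MonoidHom.mul_apply, MonoidHom.inv_apply]; group
      rw [hχχ, hgen' Wr hA] at h2
      omega
    · -- `W` does not occur in `A`
      rw [if_neg hA]
      have hA0 : Representation.mult Wr A = 0 := Nat.eq_zero_of_not_pos hA
      rw [hA0, zero_add]
      split_ifs with hAχ
      · rfl
      · have h1 := hI₁ (Representation.twist Wr χ)
        rw [Representation.twist_twist_inv, hA0, Nat.eq_zero_of_not_pos hAχ] at h1
        omega
  obtain ⟨eA⟩ : Nonempty (Representation.Equiv A (σU.prod (Representation.twist σU'' χ⁻¹))) :=
    Representation.nonempty_equiv_of_mult_eq A _ hmultA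
  /- Step 4: `C₁ ≃ σU ⊕ σU''`. -/
  have hmultC : ∀ {X : Type w} [AddCommGroup X] [Module k X] [FiniteDimensional k X]
      (Wr : Representation k Γ X) [Wr.IsIrreducible],
      Representation.mult Wr C₁ = Representation.mult Wr (σU.prod σU'') := by
    intro X _ _ _ Wr _
    rw [Representation.mult_prod, hu Wr, hu'' Wr]
    split_ifs <;> simp
  obtain ⟨eC⟩ : Nonempty (Representation.Equiv C₁ (σU.prod σU'')) :=
    Representation.nonempty_equiv_of_mult_eq C₁ _ hmultC
  /- Step 5: `σU'' ⊗ χ⁻¹ ≃ σU ∘ θ` by comparing multiplicities through `I₄`, `I₅`. -/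
  let σUθ : Representation k Γ (∀ i : {i // i ∈ S}, (T i.1).toSubmodule) := σU.comp θ
  let σU''θ : Representation k Γ (∀ i : {i // i ∈ Sᶜ}, (T i.1).toSubmodule) := σU''.comp θ
  haveI : σUθ.IsSemisimpleRepresentation := isSemisimpleRepresentation_comp σU hθ
  haveI : σU''θ.IsSemisimpleRepresentation := isSemisimpleRepresentation_comp σU'' hθ
  -- `A ≃ σU ∘ θ ⊕ (σU'' ∘ θ) ⊗ χ`
  have eAθ : Nonempty (Representation.Equiv A (σUθ.prod (Representation.twist σU''θ χ))) := by
    obtain ⟨e1⟩ := nonempty_equiv_comp eA θ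
    rw [prod_comp, twist_comp, MonoidHom.inv_comp, hχθ, inv_inv] at e1
    exact ⟨I₄.some.symm.trans e1⟩
  -- `σU ⊗ χ⁻¹ ⊕ σU'' ⊗ χ⁻¹ ≃ C₁ ⊗ χ⁻¹ ≃ C₁ ∘ θ ≃ σU ∘ θ ⊕ σU'' ∘ θ`
  have eCθ : Nonempty (Representation.Equiv
      ((Representation.twist σU χ⁻¹).prod (Representation.twist σU'' χ⁻¹)) (σUθ.prod σU''θ)) := by
    obtain ⟨e1⟩ := nonempty_equiv_comp eC θ
    rw [prod_comp] at e1
    have e2 := Representation.Equiv.twist eC χ⁻¹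
    rw [Representation.twist_prod] at e2
    exact ⟨e2.symm.trans (I₅.some.symm.trans e1)⟩
  have hmultθ : ∀ {X : Type w} [AddCommGroup X] [Module k X] [FiniteDimensional k X]
      (Wr : Representation k Γ X) [Wr.IsIrreducible],
      Representation.mult Wr (Representation.twist σU'' χ⁻¹) = Representation.mult Wr σUθ := by
    intro X _ _ _ Wr _
    obtain ⟨eα⟩ := eAθ
    obtain ⟨eβ⟩ := eCθ
    have hα := Representation.mult_congr_right Wr eα
    rw [Representation.mult_prod, Representation.mult_twist_right Wr σU''θ] at hα
    have hβ := Representation.mult_congr_right Wr eβ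
    rw [Representation.mult_prod, Representation.mult_prod, mult_twist_inv_eq, mult_twist_inv_eq,
      hu (Representation.twist Wr χ), hu'' (Representation.twist Wr χ)] at hβ
    rw [mult_twist_inv_eq, hu'' (Representation.twist Wr χ)]
    by_cases hA : 0 < Representation.mult Wr A
    · have hAχ : ¬ 0 < Representation.mult (Representation.twist Wr χ) A := by
        rw [hgen Wr hA]; exact lt_irrefl 0
      rw [if_neg hAχ]
      rw [if_neg hAχ, if_neg hAχ, zero_add] at hβ
      -- the `σU'' ∘ θ`-term at `W` vanishes: `[σU'' ∘ θ : W] ≤ [A : W ⊗ χ] = 0`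
      have hα' := Representation.mult_congr_right (Representation.twist Wr χ) eα
      rw [Representation.mult_prod, Representation.mult_twist_right (Representation.twist Wr χ)
        σU''θ, Representation.twist_twist_inv, hgen Wr hA] at hα'
      have h0 : Representation.mult Wr σU''θ = 0 := by omega
      omega
    · have hA0 : Representation.mult Wr A = 0 := Nat.eq_zero_of_not_pos hA
      rw [hA0] at hα
      have hx : Representation.mult Wr σUθ = 0 := by omega
      rw [hx]
      split_ifs with hAχ
      · rfl
      · have h1 := hI₁ (Representation.twist Wr χ)
        rw [Representation.twist_twist_inv, hA0, Nat.eq_zero_of_not_pos hAχ] at h1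
        omega
  obtain ⟨eθ⟩ : Nonempty (Representation.Equiv (Representation.twist σU'' χ⁻¹) σUθ) :=
    Representation.nonempty_equiv_of_mult_eq _ _ hmultθ
  /- Step 6: transport `σU` into `C₁` and assemble. -/
  let f : Representation.IntertwiningMap σU C₁ :=
    eC.symm.toIntertwiningMap.comp (Representation.IntertwiningMap.inl k σU σU'')
  have hf : Function.Injective f := fun x y hxy => LinearMap.inl_injective (eC.symm.injective hxy)
  let U : Subrepresentation C₁ := f.range
  have eU : Representation.Equiv σU U.toRepresentation := Subrepresentation.equivRange f hf
  obtain ⟨eUθ⟩ := nonempty_equiv_comp eU θ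
  refine ⟨U, ⟨?_⟩, ⟨?_⟩⟩
  · -- `A ≃ σU ⊕ σU'' ⊗ χ⁻¹ ≃ σU ⊕ σU ∘ θ ≃ U ⊕ U ∘ θ`
    exact eA.trans ((Representation.Equiv.prodCongr (Representation.Equiv.refl σU) eθ).trans
      (Representation.Equiv.prodCongr eU eUθ))
  · -- `C₁ ≃ σU ⊕ σU'' = σU ⊕ (σU'' ⊗ χ⁻¹) ⊗ χ ≃ U ⊕ (U ∘ θ) ⊗ χ`
    have e2 := Representation.Equiv.twist (eθ.trans eUθ) χ
    rw [Representation.twist_inv_twist] at e2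
    exact eC.trans (Representation.Equiv.prodCongr eU e2)

end Main

end TwistedSum

end Literature.NumberTheory.GaloisRepresentations
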